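/-
Origin: expansion seat `planner-pub-hodgecm-landherr-g9-0`, handover #4 2026-08-18T08:06:52Z (`HOME/pub-hodgecm-landherr-g9/lean/LandherrG9/HermSpace3Unipotent.lean`, md5 a7648c3f, 167 lines);
landed by the gen-7 packager in gate run 26 as `HodgeCM/Proofs/LandherrUnipotent.lean` (import ^import LandherrG8\.HermSpace3Similitude\b→import HodgeCM.Proofs.LandherrSimilitude ×1; import ^import LandherrG9\.HermSpace3Godement\b→import HodgeCM.Proofs.LandherrGodement ×1).
-/
/-
Copyright: pub-hodgecm formalisation cell (harness21, 2026). New file (not vendored).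
Origin: HOME/pub-hodgecm-landherr-g9/lean/LandherrG9/HermSpace3Unipotent.lean — session
planner-pub-hodgecm-landherr-g9-0 (unit pub-hodgecm-landherr-g9, EXPANSION part (c) `Lemma33bLandherr`, gen 9).
Intended final place: `HodgeCM/Proofs/LandherrUnipotent.lean` (additive leaf; imports `HodgeCM.Proofs.LandherrGodement`
(this seat's `LandherrG9/HermSpace3Godement.lean`) and `HodgeCM.Proofs.LandherrSimilitude` (landherr-g8's RUN 26
`LandherrG8/HermSpace3Similitude.lean`); nothing in the package depends on it).
-/
import Summits.HodgeConjecture.HodgeCM.Proofs.LandherrGodement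
import Summits.HodgeConjecture.HodgeCM.Proofs.LandherrSimilitude

set_option autoImplicit false

/-!
# Unipotents in `U(V₃, h)` over an imaginary quadratic field — Godement-anisotropy of `G_U` is EQUIVALENT to `[L:ℚ] ≠ 2`

`Proofs/LandherrGodement.lean` proves: `[L:ℚ] ≠ 2 ⇒` no element `≠ 1` of `U(V₃,h)(L₀)` is unipotent (Godement's anisotropy
condition for PerL's `G_U`).  This file proves the CONVERSE, making the degree hypothesis sharp: if `[L:ℚ] = 2` (the CM field
is imaginary quadratic — allowed by the package's `CMField`), then `h ≅ ⟨1, −1, −det h⟩` (`Proofs/LandherrIsotropy.lean`)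
carries the Eichler transvections `U_t = 1 + t·N`, `N = [[1,−1,0],[1,−1,0],[0,0,0]]` (`N² = 0`), `σt = −t`, which are
unipotent isometries `≠ 1`; transporting along the isometry (landherr-g8's `mem_unitaryGroup_congrAct`,
`Proofs/LandherrSimilitude.lean`) gives a unipotent `≠ 1` in `unitaryGroup σ V.Hm` for EVERY `V : HermSpace3 L ι₁`.

* `HermSpace3.transvGL_mem_unitaryGroup` — `U_t ∈ U(⟨1,−1,c⟩)` for `σt = −t`;
* **`HermSpace3.exists_unipotent_ne_one`** — `V.IsIsotropic →  ∃ g ∈ unitaryGroup σ V.Hm, g ≠ 1 ∧ (g − 1) nilpotent`;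
* **`HermSpace3.noUnipotent_iff`** — `(∀ g ∈ unitaryGroup σ V.Hm, (g − 1) nilpotent → g = 1) ↔ Module.finrank ℚ L ≠ 2`;
* `HermSpace3.anisotropic_iff` — `(∀ x, ⟪x,x⟫_h = 0 → x = 0) ↔ Module.finrank ℚ L ≠ 2` (the `∀`-shape = prl1-g4's `IsAnisotropic L V.Hm`);
* **`HermSpace3.godement_anisotropic_iff`** — `(godementDatum V.sesq Q).anisotropic ↔ Module.finrank ℚ L ≠ 2`:
  by Godement's compactness criterion (print, `Godement_Thm4`), `[G_U]` is compact EXACTLY in PerL's regime `[L:ℚ] ≥ 4`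
  (Picard modular surfaces, `[L:ℚ] = 2`, are not compact).

Pure proof; nothing cited or posited; closures are the standard trio.
-/

noncomputable section

open scoped Matrix
open NumberField
open Literature.AlgebraicGeometry.ShimuraVarieties

namespace HodgeCM

open CMField

namespace HermSpace3

open PerL34.Doubling (isom godementDatum)

variable {L : CMField} {ι₁ : L →+* ℂ}

/-! ## §1. The Eichler transvections of the hyperbolic form `⟨1, −1, c⟩` -/

section transvection

variable (L)

/-- `N = [[1,−1,0],[1,−1,0],[0,0,0]]`: `N x = (x₁ − x₂)·(1,1,0)`, `N² = 0` (its image is the isotropic line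
`L·(1,1,0)` of `⟨1,−1,c⟩`). -/
def nilN : Matrix (Fin 3) (Fin 3) L := !![1, -1, 0; 1, -1, 0; 0, 0, 0]

/-- (Ported verbatim from the HodgeCMPerL package; no docstring in the source.) -/
theorem nilN_mul_nilN : nilN L * nilN L = 0 := by
  ext i j
  fin_cases i <;> fin_cases j <;> simp [nilN, Matrix.mul_apply, Fin.sum_univ_three]

/-- The transvection `U_t = 1 + t·N`. -/
def transv (t : L) : Matrix (Fin 3) (Fin 3) L := 1 + t • nilN L

/-- (Ported verbatim from the HodgeCMPerL package; no docstring in the source.) -/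
theorem transv_sub_one (t : L) : transv L t - 1 = t • nilN L := add_sub_cancel_left _ _

/-- (Ported verbatim from the HodgeCMPerL package; no docstring in the source.) -/
theorem isNilpotent_transv_sub_one (t : L) : IsNilpotent (transv L t - 1) :=
  ⟨2, by rw [transv_sub_one, pow_two, Matrix.smul_mul, Matrix.mul_smul, nilN_mul_nilN, smul_zero, smul_zero]⟩

/-- (Ported verbatim from the HodgeCMPerL package; no docstring in the source.) -/
theorem transv_apply (t : L) (i j : Fin 3) :
    transv L t i j = (if i = j then 1 else 0) + t * nilN L i j := by
  simp [transv, Matrix.add_apply, Matrix.one_apply, Matrix.smul_apply]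

/-- (Ported verbatim from the HodgeCMPerL package; no docstring in the source.) -/
theorem det_transv (t : L) : (transv L t).det = 1 := by
  rw [Matrix.det_fin_three]
  simp [transv_apply, nilN]
  ring

/-- `U_t` as an element of `GL₃(L)`. -/
def transvGL (t : L) : GL (Fin 3) L :=
  Matrix.GeneralLinearGroup.mkOfDetNeZero (transv L t) (by rw [det_transv]; exact one_ne_zero)

/-- (Ported verbatim from the HodgeCMPerL package; no docstring in the source.) -/
@[simp] theorem coe_transvGL (t : L) : (transvGL L t : Matrix (Fin 3) (Fin 3) L) = transv L t := rfl

variable {L}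

/-- (Ported verbatim from the HodgeCMPerL package; no docstring in the source.) -/
theorem transvGL_ne_one {t : L} (ht : t ≠ 0) : transvGL L t ≠ 1 := by
  intro h
  have h01 := congrArg (fun g : GL (Fin 3) L => (g : Matrix (Fin 3) (Fin 3) L) 0 1) h
  simp [transv_apply, nilN] at h01
  exact ht h01

/-- **`U_t` is an isometry of `⟨1, −1, c⟩` when `σt = −t`.** -/
theorem transvGL_mem_unitaryGroup {t : L} (ht : conjRingHomK L t = -t) (c : L) :
    transvGL L t ∈ unitaryGroup (conjRingHomK L) (Matrix.diagonal ![(1 : L), -1, c]) := by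
  rw [mem_unitaryGroup_iff, coe_transvGL]
  ext i j
  fin_cases i <;> fin_cases j <;>
    simp [Matrix.mul_apply, Fin.sum_univ_three, Matrix.diagonal, transv_apply, nilN, ht] <;> ring

end transvection

/-! ## §2. Unipotents in `U(V₃, h)` for isotropic `h` -/

/-- **An isotropic `(V₃, h)` has a unipotent isometry `≠ 1`.** -/
theorem exists_unipotent_ne_one (V : HermSpace3 L ι₁) (hV : V.IsIsotropic) :
    ∃ g ∈ unitaryGroup (conjRingHomK L) V.Hm, g ≠ 1 ∧ IsNilpotent ((g : Matrix (Fin 3) (Fin 3) L) - 1) := by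
  obtain ⟨x, hx⟩ := (isIsotropic_iff_isometric_hyperbolic V).mp hV
  obtain ⟨θ, hθ0, hθ⟩ := Lemma33bLandherrProof.exists_skew L
  have hu : transvGL L θ ∈ unitaryGroup (conjRingHomK L) (congrAct L (x : Matrix (Fin 3) (Fin 3) L) V.Hm) := by
    rw [congrAct, hx]
    exact transvGL_mem_unitaryGroup hθ _
  refine ⟨x * transvGL L θ * x⁻¹, (mem_unitaryGroup_congrAct x _ V.Hm).mp hu, ?_, ?_⟩
  · intro h
    apply transvGL_ne_one (L := L) hθ0
    have := congrArg (fun g => x⁻¹ * g * x) h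
    simpa [mul_assoc] using this
  · have hc : ((x * transvGL L θ * x⁻¹ : GL (Fin 3) L) : Matrix (Fin 3) (Fin 3) L) - 1 =
        (x : Matrix (Fin 3) (Fin 3) L) * (transv L θ - 1) * ((x⁻¹ : GL (Fin 3) L) : Matrix (Fin 3) (Fin 3) L) := by
      rw [Units.val_mul, Units.val_mul, coe_transvGL, mul_sub, sub_mul, mul_one, Units.mul_inv]
    rw [hc]
    obtain ⟨k, hk⟩ := isNilpotent_transv_sub_one L θ
    exact ⟨k, by rw [Units.conj_pow, hk, mul_zero, zero_mul]⟩

/-- **No unipotents in `U(V₃, h)(L₀)` iff `[L:ℚ] ≠ 2`** (matrix form). -/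
theorem noUnipotent_iff (V : HermSpace3 L ι₁) :
    (∀ g ∈ unitaryGroup (conjRingHomK L) V.Hm, IsNilpotent ((g : Matrix (Fin 3) (Fin 3) L) - 1) → g = 1) ↔
      Module.finrank ℚ L ≠ 2 := by
  constructor
  · intro h hL
    obtain ⟨g, hg, hne, hn⟩ := exists_unipotent_ne_one V ((isIsotropic_iff_finrank_eq_two V).mpr hL)
    exact hne (h g hg hn)
  · intro hL g hg hn
    exact eq_one_of_unipotent V hL hg hn

/-- **`h` is anisotropic (`⟪x,x⟫_h = 0 ⇒ x = 0`) iff `[L:ℚ] ≠ 2`** — the `∀`-shape of `isIsotropic_iff_finrank_eq_two`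
(`Proofs/LandherrIsotropy.lean`); this is verbatim the shape of prl1-g4's `IsAnisotropic L V.Hm`
(`Automorphic/AdelicUnitaryModel.lean`, RUN 26), whose `HermSpace3.isAnisotropic` is the direction `4 ≤ [L:ℚ] ⇒`. -/
theorem anisotropic_iff (V : HermSpace3 L ι₁) :
    (∀ x : Fin 3 → L, hermForm (conjRingHomK L) V.Hm x x = 0 → x = 0) ↔ Module.finrank ℚ L ≠ 2 := by
  rw [Ne, ← isIsotropic_iff_finrank_eq_two V, IsIsotropic, not_exists]
  exact forall_congr' fun x => by rw [not_and', not_not]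

/-- **Godement-anisotropy of `G_U = U(V₃, h)` is EQUIVALENT to `[L:ℚ] ≠ 2`.**  With Godement's criterion (print,
`Godement_Thm4`): `[G_U]` is compact exactly when the CM field is not imaginary quadratic. -/
theorem godement_anisotropic_iff (V : HermSpace3 L ι₁) (Q : Prop) :
    (godementDatum V.sesq Q).anisotropic ↔ Module.finrank ℚ L ≠ 2 := by
  refine ⟨fun h hL => ?_, fun hL => godement_anisotropic V hL Q⟩
  obtain ⟨g, hg, hne, hn⟩ := exists_unipotent_ne_one V ((isIsotropic_iff_finrank_eq_two V).mpr hL)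
  have h1 : (⟨glEquiv L (Fin 3) g, (mem_isom_sesq_iff V g).mpr hg⟩ : isom V.sesq) = 1 :=
    h _ ((isNilpotent_glEquiv_sub_one_iff g).mpr hn)
  exact hne ((glEquiv L (Fin 3)).injective (by rw [map_one]; exact congrArg Subtype.val h1))

/-- With Godement's Thm 4 (hypothesis) the compactness proposition of `[G_U]` holds iff `[L:ℚ] ≠ 2`. -/
theorem compact_iff_of_godement_thm4 (V : HermSpace3 L ι₁) (Q : Prop)
    (thm4 : (godementDatum V.sesq Q).Godement_Thm4) : Q ↔ Module.finrank ℚ L ≠ 2 := by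
  rw [← godement_anisotropic_iff V Q]
  exact thm4

end HermSpace3

end HodgeCM

end
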